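import Mathlib
import Summits.MatrixMultiplication.MatrixMultiplication.Theorems.SnSubsetDichotomyPolynomialSlackHubDyadic
import Summits.MatrixMultiplication.MatrixMultiplication.Theorems.SnSubsetDichotomyPolynomialSlackHubSelect
import Summits.MatrixMultiplication.MatrixMultiplication.Theorems.SnSubsetDichotomyPolynomialSlackSpreadLevelOne

/-!
# The sharp hub bound: one dense quotient via the general hub lemma

Crux `Summit.MatrixMultiplication.MatrixMultiplication.Theses.SnSubsetDichotomy.PolynomialSlack`
(item `stmt-MatrixMultiplication-8306`), level-one programme, lead c8 (one dense quotient: the sharp hub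
bound), line transport-split-hull. For a TPP triple `S, T, U ⊆ S_n` of non-empty sets with quotient
profiles `d_A = m_{ST}/|S||T|`, `d_B = m_{TU}/|T||U|`, `d_C = m_{US}/|U||S|`, heavy thresholds
`θ_B, θ_C ≥ 16/n`, heavy parts `p_X = (d_X - 1/n)·[d_X ≥ θ_X]`, heavy masses `≤ Λ` (one of them
`≤ 1 + δ₄`), the kept level-one inequality `1 - δ ≤ -(n-1)Σ (d_A - 1/n) p_B p_C` (file `…KeptTerm`) and
`δ + δ₄ ≤ 1/(7776Λ²(1+log n)⁴)`:

  `|S||T||U| ≤ 10368·9600²·(1+log n)⁶·Λ²·log²(6·n!/(|S||T|))·n·B`     (`volume_le_of_hub_sharp`)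

for every bound `B` on the volumes of TPP triples of `S_{n-1}` — the SHARP form of `volume_le_of_hub`
(file `…HubVolume`, whose steps 0–6 are repeated here). Proof: the kept term is
`((n-1)/n)Σ_k σ_kρ_k - (n-1)Ψ` (column/row heavy masses `σ_k, ρ_k ∈ [0,1]`, nonnegative `Ψ`), and
`Σ_k σ_kρ_k ≤ min(Σσ, Σρ) ≤ 1 + δ₄` gives the sharp bound `(n-1)Ψ ≤ δ + δ₄`; `exists_hub_of_masses`
picks a hub `k` with `σ_k + ρ_k - 1 ≥ 1/(4Λ) = 2q` (`q = 1/(8Λ)`); for the heavy sets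
`J = {j : d_B(j,k) ≥ θ_B}`, `I = {i : d_C(k,i) ≥ θ_C}` the hub mass is
`Σ_v μ X_J Y_I ≥ Σ_v μ (X_J + Y_I - 1) ≥ σ_k + ρ_k - 1 ≥ 2q` (`sum_pairMarginal_col/row_block_eq`,
`(1-X)(1-Y) ≥ 0`), the block weight is `Σ_{I×J} d_A d_B d_C ≤ (16/15)²Ψ ≤ 3(δ+δ₄)/n = η/n`
(`d_B ≤ (16/15)p_B` on heavy cells), the links are `≥ 16/n ≥ 1/n²`, and `81(1+log n)⁴η ≤ 2q²`; the
general hub lemma `hub_volume_dyadic` gives `|S||T||U| ≤ 9600²·9⁴·(1+log n)^{10}·L²·n·η·B/q⁴`, and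
`9⁴·η/q⁴ = 9⁴·3·8⁴·Λ⁴(δ+δ₄) ≤ 10368·Λ²/(1+log n)⁴` (`hubSharp_const`).
-/

namespace Summit.MatrixMultiplication.MatrixMultiplication.Theorems.PolynomialSlack

open scoped BigOperators
open Literature.Combinatorics.Additive (TripleProductProperty)

-- `Summit.<Summit>.<Problem>` is the tree's mandated summit-side namespace (CONVENTIONS §2); for
-- this single-conjunct summit the two coincide, so each declaration silences `dupNamespace`.
set_option linter.dupNamespace false

/-- The arithmetic of the sharp hub bound: if `s ≤ 1/(7776Λ²G⁴)` (`G ≥ 1`, `Λ > 0`, `m, b ≥ 0`) then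
`9600²·9⁴·G^{10}·L²·m·(3s)·b/(1/(8Λ))⁴ ≤ 10368·9600²·G⁶·Λ²·L²·m·b` (`9⁴·3·8⁴ = 10368·7776`). [folklore] -/
theorem hubSharp_const {G Λ L m b s N : ℝ} (hG : 1 ≤ G) (hΛ : 0 < Λ) (hm : 0 ≤ m) (hb : 0 ≤ b)
    (hsmall : s ≤ 1 / (7776 * Λ ^ 2 * G ^ 4))
    (hN : N ≤ 9600 ^ 2 * 9 ^ 4 * G ^ 10 * L ^ 2 * m * (3 * s) * b / (1 / (8 * Λ)) ^ 4) :
    N ≤ 10368 * 9600 ^ 2 * G ^ 6 * Λ ^ 2 * L ^ 2 * m * b := by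
  have hG0 : 0 < G := by linarith
  have hGne : G ≠ 0 := hG0.ne'
  have hΛne : Λ ≠ 0 := hΛ.ne'
  have hsm : s * (7776 * Λ ^ 2 * G ^ 4) ≤ 1 := (le_div_iff₀ (by positivity)).1 hsmall
  have key : 9600 ^ 2 * 9 ^ 4 * G ^ 10 * L ^ 2 * m * (3 * s) * b / (1 / (8 * Λ)) ^ 4 =
      10368 * 9600 ^ 2 * G ^ 6 * Λ ^ 2 * L ^ 2 * m * b * (s * (7776 * Λ ^ 2 * G ^ 4)) := by
    field_simp
    ring
  rw [key] at hN
  have hR : 0 ≤ 10368 * 9600 ^ 2 * G ^ 6 * Λ ^ 2 * L ^ 2 * m * b := by positivity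
  calc N ≤ _ := hN
    _ ≤ 10368 * 9600 ^ 2 * G ^ 6 * Λ ^ 2 * L ^ 2 * m * b * 1 := mul_le_mul_of_nonneg_left hsm hR
    _ = _ := mul_one _

set_option maxHeartbeats 1600000 in
/-- **The sharp hub bound.** For `n ≥ 2`, a TPP triple `S, T, U ⊆ S_n` of non-empty sets, a bound `B`
on the volumes of TPP triples of `S_{n-1}`, quotient profiles `dA, dB, dC`, heavy thresholds
`θB, θC ≥ 16/n` with heavy parts `pB, pC`, heavy masses `≤ Λ` (one of them `≤ 1 + δ₄`), `δ > 0`,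
`δ + δ₄ ≤ 1/(7776Λ²(1+log n)⁴)`, and the kept level-one inequality `1 - δ ≤ -(n-1)·Σ (dA - 1/n)·pB·pC`:
`|S||T||U| ≤ 10368·9600²·(1+log n)⁶·Λ²·log²(6n!/(|S||T|))·n·B`. [folklore] -/
theorem volume_le_of_hub_sharp {n : ℕ} (hn : 2 ≤ n) (B : ℕ)
    (hB : ∀ S' T' U' : Finset (Equiv.Perm (Fin (n - 1))), TripleProductProperty S' T' U' →
      S'.card * T'.card * U'.card ≤ B)
    {S T U : Finset (Equiv.Perm (Fin n))} (hTPP : TripleProductProperty S T U)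
    (hS0 : S.Nonempty) (hT0 : T.Nonempty) (hU0 : U.Nonempty)
    (dA dB dC pB pC : Fin n → Fin n → ℝ)
    (hdA : ∀ i j, dA i j = (((S ×ˢ T).filter fun st => st.2 j = st.1 i).card : ℝ) / (S.card * T.card : ℕ))
    (hdB : ∀ j k, dB j k = (((T ×ˢ U).filter fun tu => tu.2 k = tu.1 j).card : ℝ) / (T.card * U.card : ℕ))
    (hdC : ∀ k i, dC k i = (((U ×ˢ S).filter fun us => us.2 i = us.1 k).card : ℝ) / (U.card * S.card : ℕ))
    (θB θC Λ δ δ₄ : ℝ) (hθB : 16 / (n : ℝ) ≤ θB) (hθC : 16 / (n : ℝ) ≤ θC)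
    (hpB : ∀ j k, pB j k = if θB ≤ dB j k then dB j k - 1 / n else 0)
    (hpC : ∀ k i, pC k i = if θC ≤ dC k i then dC k i - 1 / n else 0)
    (hΛ : 1 ≤ Λ) (hδ : 0 < δ) (hδ₄ : 0 ≤ δ₄)
    (hsmall : δ + δ₄ ≤ 1 / (7776 * Λ ^ 2 * (1 + Real.log n) ^ 4))
    (hmassB : ∑ j : Fin n, ∑ k : Fin n, (if θB ≤ dB j k then dB j k else 0) ≤ Λ)
    (hmassC : ∑ k : Fin n, ∑ i : Fin n, (if θC ≤ dC k i then dC k i else 0) ≤ Λ)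
    (hsharp : ∑ j : Fin n, ∑ k : Fin n, (if θB ≤ dB j k then dB j k else 0) ≤ 1 + δ₄ ∨
      ∑ k : Fin n, ∑ i : Fin n, (if θC ≤ dC k i then dC k i else 0) ≤ 1 + δ₄)
    (hkept : 1 - δ ≤ -((n : ℝ) - 1) *
      ∑ i : Fin n, ∑ j : Fin n, ∑ k : Fin n, (dA i j - 1 / n) * pB j k * pC k i) :
    ((S.card * T.card * U.card : ℕ) : ℝ) ≤
      10368 * 9600 ^ 2 * (1 + Real.log n) ^ 6 * Λ ^ 2 *
        (Real.log (6 * n.factorial / (S.card * T.card : ℕ))) ^ 2 * n * B := by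
  classical
  /- 0. scalars -/
  have hnR : (2 : ℝ) ≤ n := by exact_mod_cast hn
  have hn0 : (0 : ℝ) < n := by linarith
  have hm0 : (0 : ℝ) < (n : ℝ) - 1 := by linarith
  have h16n : (0 : ℝ) < 16 / n := by positivity
  have hθB0 : 0 < θB := lt_of_lt_of_le h16n hθB
  have hθC0 : 0 < θC := lt_of_lt_of_le h16n hθC
  have hΛ0 : 0 < Λ := by linarith
  have h16 : (0 : ℝ) < 16 := by norm_num
  have hinvB : 1 / (n : ℝ) ≤ θB / 16 := by
    rw [div_le_div_iff₀ hn0 h16]; rw [div_le_iff₀ hn0] at hθB; linarith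
  have hinvC : 1 / (n : ℝ) ≤ θC / 16 := by
    rw [div_le_div_iff₀ hn0 h16]; rw [div_le_iff₀ hn0] at hθC; linarith
  have hG1 : (1 : ℝ) ≤ 1 + Real.log n := by
    linarith [Real.log_nonneg (show (1 : ℝ) ≤ n by linarith)]
  have hG0 : (0 : ℝ) < 1 + Real.log n := by linarith
  have hδδ : 0 < δ + δ₄ := by linarith
  -- `δ + δ₄ ≤ 1/(64Λ²)` (the hypothesis of the hub selection)
  have hsmall64 : δ + δ₄ ≤ 1 / (64 * Λ ^ 2) := by
    refine hsmall.trans (one_div_le_one_div_of_le (by positivity) ?_)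
    have hG4 : (1 : ℝ) ≤ (1 + Real.log n) ^ 4 := one_le_pow₀ hG1
    have hΛ2 : (0 : ℝ) ≤ Λ ^ 2 := sq_nonneg Λ
    nlinarith [mul_le_mul_of_nonneg_left hG4 hΛ2]
  set cS : ℝ := (S.card : ℝ) with hcS
  set cT : ℝ := (T.card : ℝ) with hcT
  set cU : ℝ := (U.card : ℝ) with hcU
  have hcS0 : 0 < cS := by rw [hcS]; exact_mod_cast hS0.card_pos
  have hcT0 : 0 < cT := by rw [hcT]; exact_mod_cast hT0.card_pos
  have hcU0 : 0 < cU := by rw [hcU]; exact_mod_cast hU0.card_pos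
  have hαe : ((S.card * T.card : ℕ) : ℝ) = cS * cT := by push_cast; rw [hcS, hcT]
  have hβe : ((T.card * U.card : ℕ) : ℝ) = cT * cU := by push_cast; rw [hcT, hcU]
  have hγe : ((U.card * S.card : ℕ) : ℝ) = cU * cS := by push_cast; rw [hcU, hcS]
  have hTfil : ∀ (p : Equiv.Perm (Fin n) → Prop) [DecidablePred p], ((T.filter p).card : ℝ) ≤ cT :=
    fun p _ => by rw [hcT]; exact_mod_cast Finset.card_filter_le _ _
  have hSfil : ∀ (p : Equiv.Perm (Fin n) → Prop) [DecidablePred p], ((S.filter p).card : ℝ) ≤ cS :=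
    fun p _ => by rw [hcS]; exact_mod_cast Finset.card_filter_le _ _
  have hUcol : ∀ k : Fin n, ∑ v : Fin n, ((U.filter fun u => u k = v).card : ℝ) = cU := fun k => by
    rw [hcU]; exact sum_marginal_col U k
  have hcUne : cU ≠ 0 := hcU0.ne'
  clear_value cS cT cU
  /- 1. the marginals and the profiles -/
  set mA : Fin n → Fin n → ℝ := fun i j => (((S ×ˢ T).filter fun st => st.2 j = st.1 i).card : ℝ) with hmA
  set mB : Fin n → Fin n → ℝ := fun j k => (((T ×ˢ U).filter fun tu => tu.2 k = tu.1 j).card : ℝ) with hmB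
  set mC : Fin n → Fin n → ℝ := fun k i => (((U ×ˢ S).filter fun us => us.2 i = us.1 k).card : ℝ) with hmC
  have hdA' : ∀ i j, dA i j = mA i j / (cS * cT) := fun i j => by rw [hdA, hαe]
  have hdB' : ∀ j k, dB j k = mB j k / (cT * cU) := fun j k => by rw [hdB, hβe]
  have hdC' : ∀ k i, dC k i = mC k i / (cU * cS) := fun k i => by rw [hdC, hγe]
  have hmA0 : ∀ i j, 0 ≤ mA i j := fun i j => by simp only [hmA]; exact Nat.cast_nonneg _
  have hmB0 : ∀ j k, 0 ≤ mB j k := fun j k => by simp only [hmB]; exact Nat.cast_nonneg _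
  have hmC0 : ∀ k i, 0 ≤ mC k i := fun k i => by simp only [hmC]; exact Nat.cast_nonneg _
  have hdA0 : ∀ i j, 0 ≤ dA i j := fun i j => (hdA' i j).symm ▸ div_nonneg (hmA0 i j) (mul_pos hcS0 hcT0).le
  have hdB0 : ∀ j k, 0 ≤ dB j k := fun j k => (hdB' j k).symm ▸ div_nonneg (hmB0 j k) (mul_pos hcT0 hcU0).le
  have hdC0 : ∀ k i, 0 ≤ dC k i := fun k i => (hdC' k i).symm ▸ div_nonneg (hmC0 k i) (mul_pos hcU0 hcS0).le
  -- column sums of `dB` and row sums of `dC` are `1`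
  have hcolB : ∀ k, ∑ j : Fin n, dB j k = 1 := by
    intro k
    have h := sum_pairMarginal_fst T U k
    have h' : ∑ j : Fin n, mB j k = cT * cU := by
      simp only [hmB, hcT, hcU]; exact_mod_cast h
    simp_rw [hdB' _ k]
    rw [← Finset.sum_div, h', div_self (mul_pos hcT0 hcU0).ne']
  have hrowC : ∀ k, ∑ i : Fin n, dC k i = 1 := by
    intro k
    have h := sum_pairMarginal_snd U S k
    have h' : ∑ i : Fin n, mC k i = cU * cS := by
      simp only [hmC, hcU, hcS]; exact_mod_cast h
    simp_rw [hdC' k]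
    rw [← Finset.sum_div, h', div_self (mul_pos hcU0 hcS0).ne']
  clear_value mA mB mC
  /- 2. the heavy parts -/
  have h1n : (0 : ℝ) ≤ 1 / n := by positivity
  have hpB0 : ∀ j k, 0 ≤ pB j k := by
    intro j k; rw [hpB]; split_ifs with h <;> linarith [hinvB, hθB0]
  have hpC0 : ∀ k i, 0 ≤ pC k i := by
    intro k i; rw [hpC]; split_ifs with h <;> linarith [hinvC, hθC0]
  have hpBle : ∀ j k, pB j k ≤ (if θB ≤ dB j k then dB j k else 0) := by
    intro j k; rw [hpB]; split_ifs with h <;> linarith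
  have hpCle : ∀ k i, pC k i ≤ (if θC ≤ dC k i then dC k i else 0) := by
    intro k i; rw [hpC]; split_ifs with h <;> linarith
  have hifB : ∀ j k, (if θB ≤ dB j k then dB j k else 0) ≤ dB j k := fun j k => by
    split_ifs <;> linarith [hdB0 j k]
  have hifC : ∀ k i, (if θC ≤ dC k i then dC k i else 0) ≤ dC k i := fun k i => by
    split_ifs <;> linarith [hdC0 k i]
  -- on heavy cells `dB ≤ (16/15) pB`, `dC ≤ (16/15) pC` (as `1/n ≤ θ/16 ≤ d/16`)
  have hdBp : ∀ j k, θB ≤ dB j k → dB j k ≤ 16 / 15 * pB j k := fun j k h => by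
    rw [hpB, if_pos h]; linarith [hinvB]
  have hdCp : ∀ k i, θC ≤ dC k i → dC k i ≤ 16 / 15 * pC k i := fun k i h => by
    rw [hpC, if_pos h]; linarith [hinvC]
  /- 3. column / row heavy masses -/
  set σ : Fin n → ℝ := fun k => ∑ j : Fin n, pB j k with hσ
  set ρ : Fin n → ℝ := fun k => ∑ i : Fin n, pC k i with hρ
  have hσk : ∀ k, σ k = ∑ j : Fin n, pB j k := fun k => rfl
  have hρk : ∀ k, ρ k = ∑ i : Fin n, pC k i := fun k => rfl
  clear_value σ ρ
  have hσ0 : ∀ k, 0 ≤ σ k := fun k => by rw [hσk]; exact Finset.sum_nonneg fun j _ => hpB0 j k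
  have hρ0 : ∀ k, 0 ≤ ρ k := fun k => by rw [hρk]; exact Finset.sum_nonneg fun i _ => hpC0 k i
  have hσ1 : ∀ k, σ k ≤ 1 := fun k => by
    rw [hσk, ← hcolB k]; exact Finset.sum_le_sum fun j _ => (hpBle j k).trans (hifB j k)
  have hρ1 : ∀ k, ρ k ≤ 1 := fun k => by
    rw [hρk, ← hrowC k]; exact Finset.sum_le_sum fun i _ => (hpCle k i).trans (hifC k i)
  have hσsum : ∑ k : Fin n, σ k ≤ ∑ j : Fin n, ∑ k : Fin n, (if θB ≤ dB j k then dB j k else 0) := by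
    calc ∑ k : Fin n, σ k = ∑ k : Fin n, ∑ j : Fin n, pB j k := Finset.sum_congr rfl fun k _ => hσk k
      _ = ∑ j : Fin n, ∑ k : Fin n, pB j k := Finset.sum_comm
      _ ≤ ∑ j : Fin n, ∑ k : Fin n, (if θB ≤ dB j k then dB j k else 0) :=
          Finset.sum_le_sum fun j _ => Finset.sum_le_sum fun k _ => hpBle j k
  have hρsum : ∑ k : Fin n, ρ k ≤ ∑ k : Fin n, ∑ i : Fin n, (if θC ≤ dC k i then dC k i else 0) := by
    calc ∑ k : Fin n, ρ k = ∑ k : Fin n, ∑ i : Fin n, pC k i := Finset.sum_congr rfl fun k _ => hρk k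
      _ ≤ ∑ k : Fin n, ∑ i : Fin n, (if θC ≤ dC k i then dC k i else 0) :=
          Finset.sum_le_sum fun k _ => Finset.sum_le_sum fun i _ => hpCle k i
  have hσΛ : ∑ k : Fin n, σ k ≤ Λ := hσsum.trans hmassB
  have hρΛ : ∑ k : Fin n, ρ k ≤ Λ := hρsum.trans hmassC
  have hsharp' : ∑ k : Fin n, σ k ≤ 1 + δ₄ ∨ ∑ k : Fin n, ρ k ≤ 1 + δ₄ :=
    hsharp.imp (fun h => hσsum.trans h) (fun h => hρsum.trans h)
  /- 4. the kept term: `Σ (dA - 1/n) pB pC = Ψ - (1/n) Σ_k σ_k ρ_k`, and the SHARP bound on `Ψ` -/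
  set Ψ : ℝ := ∑ i : Fin n, ∑ j : Fin n, ∑ k : Fin n, dA i j * pB j k * pC k i with hΨ
  have hΨ0 : 0 ≤ Ψ := Finset.sum_nonneg fun i _ => Finset.sum_nonneg fun j _ =>
    Finset.sum_nonneg fun k _ => mul_nonneg (mul_nonneg (hdA0 i j) (hpB0 j k)) (hpC0 k i)
  have hprod : ∑ i : Fin n, ∑ j : Fin n, ∑ k : Fin n, pB j k * pC k i = ∑ k : Fin n, σ k * ρ k := by
    rw [Finset.sum_comm]
    rw [Finset.sum_congr rfl fun j _ => Finset.sum_comm]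
    rw [Finset.sum_comm]
    refine Finset.sum_congr rfl fun k _ => ?_
    rw [hσk, hρk, Finset.sum_mul_sum]
  have hkept' : ∑ i : Fin n, ∑ j : Fin n, ∑ k : Fin n, (dA i j - 1 / n) * pB j k * pC k i =
      Ψ - 1 / n * ∑ k : Fin n, σ k * ρ k := by
    rw [← hprod, hΨ, Finset.mul_sum, ← Finset.sum_sub_distrib]
    refine Finset.sum_congr rfl fun i _ => ?_
    rw [Finset.mul_sum, ← Finset.sum_sub_distrib]
    refine Finset.sum_congr rfl fun j _ => ?_
    rw [Finset.mul_sum, ← Finset.sum_sub_distrib]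
    refine Finset.sum_congr rfl fun k _ => ?_
    ring
  rw [hkept'] at hkept
  set Sσρ : ℝ := ∑ k : Fin n, σ k * ρ k with hSdef
  -- `hkept : 1 - δ ≤ -(n-1) * (Ψ - 1/n * Sσρ)`
  have hrew : -((n : ℝ) - 1) * (Ψ - 1 / n * Sσρ) = ((n : ℝ) - 1) / n * Sσρ - ((n : ℝ) - 1) * Ψ := by
    field_simp; ring
  rw [hrew] at hkept
  have hS0' : 0 ≤ Sσρ := Finset.sum_nonneg fun k _ => mul_nonneg (hσ0 k) (hρ0 k)
  have hfrac : ((n : ℝ) - 1) / n * Sσρ ≤ Sσρ := by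
    have : ((n : ℝ) - 1) / n ≤ 1 := by rw [div_le_one hn0]; linarith
    nlinarith
  have hmΨ : 0 ≤ ((n : ℝ) - 1) * Ψ := mul_nonneg hm0.le hΨ0
  have hmass : 1 - δ ≤ Sσρ := by linarith
  -- the sharp total: `Sσρ ≤ min (Σ σ, Σ ρ) ≤ 1 + δ₄`, whence `(n-1)Ψ ≤ δ + δ₄`
  have hSsharp : Sσρ ≤ 1 + δ₄ := by
    rcases hsharp' with h | h
    · calc Sσρ = ∑ k : Fin n, σ k * ρ k := rfl
        _ ≤ ∑ k : Fin n, σ k := Finset.sum_le_sum fun k _ => by nlinarith [hσ0 k, hρ0 k, hρ1 k]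
        _ ≤ 1 + δ₄ := h
    · calc Sσρ = ∑ k : Fin n, σ k * ρ k := rfl
        _ ≤ ∑ k : Fin n, ρ k := Finset.sum_le_sum fun k _ => by nlinarith [hσ0 k, hρ0 k, hσ1 k]
        _ ≤ 1 + δ₄ := h
  have hΨδ : ((n : ℝ) - 1) * Ψ ≤ δ + δ₄ := by linarith
  have hΨn : Ψ ≤ 2 * (δ + δ₄) / n := by
    rw [le_div_iff₀ hn0]
    nlinarith [mul_nonneg hδδ.le (sub_nonneg.2 hnR)]
  /- 5. the hub -/
  obtain ⟨k, hk⟩ := exists_hub_of_masses σ ρ Λ δ δ₄ hσ0 hσ1 hρ0 hρ1 hΛ hσΛ hρΛ hδ.le hδ₄ hsmall64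
    hsharp' hmass
  -- heavy sets at the hub
  set J : Finset (Fin n) := Finset.univ.filter fun j => θB ≤ dB j k with hJ
  set I : Finset (Fin n) := Finset.univ.filter fun i => θC ≤ dC k i with hI
  have hmemJ : ∀ j ∈ J, θB ≤ dB j k := fun j hj => (Finset.mem_filter.1 hj).2
  have hmemI : ∀ i ∈ I, θC ≤ dC k i := fun i hi => (Finset.mem_filter.1 hi).2
  have hsumJ : ∑ j ∈ J, dB j k = ∑ j : Fin n, (if θB ≤ dB j k then dB j k else 0) := by
    rw [hJ, Finset.sum_filter]
  have hsumI : ∑ i ∈ I, dC k i = ∑ i : Fin n, (if θC ≤ dC k i then dC k i else 0) := by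
    rw [hI, Finset.sum_filter]
  clear_value J I
  -- link floors: `dB j k, dC k i ≥ 16/n ≥ 1/n²` on the heavy sets
  have hn2inv : 1 / (n : ℝ) ^ 2 ≤ 16 / n := by
    rw [div_le_div_iff₀ (by positivity) hn0]; nlinarith
  have hJ' : ∀ j ∈ J, 1 / (n : ℝ) ^ 2 ≤ dB j k := fun j hj => hn2inv.trans (hθB.trans (hmemJ j hj))
  have hI' : ∀ i ∈ I, 1 / (n : ℝ) ^ 2 ≤ dC k i := fun i hi => hn2inv.trans (hθC.trans (hmemI i hi))
  /- 6. the three laws at the hub -/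
  set μ : Fin n → ℝ := fun v => ((U.filter fun u => u k = v).card : ℝ) / cU with hμ
  set X : Fin n → ℝ := fun v => ((T.filter fun t => t⁻¹ v ∈ J).card : ℝ) / cT with hX
  set Y : Fin n → ℝ := fun v => ((S.filter fun s => s⁻¹ v ∈ I).card : ℝ) / cS with hY
  have hμ0 : ∀ v, 0 ≤ μ v := fun v => by rw [hμ]; exact div_nonneg (Nat.cast_nonneg _) hcU0.le
  have hX0 : ∀ v, 0 ≤ X v := fun v => by rw [hX]; exact div_nonneg (Nat.cast_nonneg _) hcT0.le
  have hY0 : ∀ v, 0 ≤ Y v := fun v => by rw [hY]; exact div_nonneg (Nat.cast_nonneg _) hcS0.le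
  have hX1 : ∀ v, X v ≤ 1 := fun v => by
    rw [hX]; dsimp only; rw [div_le_one hcT0]
    exact hTfil _
  have hY1 : ∀ v, Y v ≤ 1 := fun v => by
    rw [hY]; dsimp only; rw [div_le_one hcS0]
    exact hSfil _
  have hμ1 : ∑ v : Fin n, μ v = 1 := by
    rw [hμ]; dsimp only
    rw [← Finset.sum_div, hUcol k, div_self hcUne]
  clear_value μ X Y
  -- scalar identities (kept free of the big definitions)
  have key2U : ∀ a b : ℝ, a / cU * (b / cT) = a * b / (cT * cU) := by
    intro a b; rw [div_mul_div_comm, mul_comm cU cT]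
  have key2S : ∀ a b : ℝ, a / cU * (b / cS) = a * b / (cU * cS) := by
    intro a b; rw [div_mul_div_comm]
  -- `Σ_v μ X = Σ_{j ∈ J} dB j k ≥ σ k`
  have hμX : σ k ≤ ∑ v : Fin n, μ v * X v := by
    have hcol := sum_pairMarginal_col_block_eq T U J k
    have hcolR : ∑ j ∈ J, mB j k = ∑ v : Fin n,
        ((U.filter fun u => u k = v).card : ℝ) * ((T.filter fun t => t⁻¹ v ∈ J).card : ℝ) := by
      simp only [hmB]; exact_mod_cast hcol
    have e1 : ∑ v : Fin n, μ v * X v = (∑ j ∈ J, mB j k) / (cT * cU) := by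
      rw [hcolR, Finset.sum_div]
      refine Finset.sum_congr rfl fun v _ => ?_
      rw [hμ, hX]; dsimp only
      rw [key2U]
    have e2 : (∑ j ∈ J, mB j k) / (cT * cU) = ∑ j ∈ J, dB j k := by
      rw [Finset.sum_div]
      exact Finset.sum_congr rfl fun j _ => (hdB' j k).symm
    rw [e1, e2]
    calc σ k = ∑ j : Fin n, pB j k := hσk k
      _ ≤ ∑ j : Fin n, (if θB ≤ dB j k then dB j k else 0) := Finset.sum_le_sum fun j _ => hpBle j k
      _ = ∑ j ∈ J, dB j k := hsumJ.symm
  -- `Σ_v μ Y = Σ_{i ∈ I} dC k i ≥ ρ k`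
  have hμY : ρ k ≤ ∑ v : Fin n, μ v * Y v := by
    have hrow := sum_pairMarginal_row_block_eq U S I k
    have hrowR : ∑ i ∈ I, mC k i = ∑ v : Fin n,
        ((U.filter fun u => u k = v).card : ℝ) * ((S.filter fun s => s⁻¹ v ∈ I).card : ℝ) := by
      simp only [hmC]; exact_mod_cast hrow
    have e1 : ∑ v : Fin n, μ v * Y v = (∑ i ∈ I, mC k i) / (cU * cS) := by
      rw [hrowR, Finset.sum_div]
      refine Finset.sum_congr rfl fun v _ => ?_
      rw [hμ, hY]; dsimp only
      rw [key2S]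
    have e2 : (∑ i ∈ I, mC k i) / (cU * cS) = ∑ i ∈ I, dC k i := by
      rw [Finset.sum_div]
      exact Finset.sum_congr rfl fun i _ => (hdC' k i).symm
    rw [e1, e2]
    calc ρ k = ∑ i : Fin n, pC k i := hρk k
      _ ≤ ∑ i : Fin n, (if θC ≤ dC k i then dC k i else 0) := Finset.sum_le_sum fun i _ => hpCle k i
      _ = ∑ i ∈ I, dC k i := hsumI.symm
  /- 7. the hub mass: `Σ_v μ X Y ≥ Σ_v μ (X + Y - 1) ≥ σ_k + ρ_k - 1 ≥ 1/(4Λ) = 2q` -/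
  have hXY : ∀ v, μ v * (X v + Y v - 1) ≤ μ v * (X v * Y v) := fun v =>
    mul_le_mul_of_nonneg_left
      (by nlinarith [mul_nonneg (sub_nonneg.2 (hX1 v)) (sub_nonneg.2 (hY1 v))]) (hμ0 v)
  have hlowμ : 2 * (1 / (8 * Λ)) ≤ ∑ v : Fin n, μ v * (X v * Y v) := by
    calc 2 * (1 / (8 * Λ)) = 1 / (4 * Λ) := by ring
      _ ≤ σ k + ρ k - 1 := hk
      _ ≤ ∑ v : Fin n, μ v * X v + ∑ v : Fin n, μ v * Y v - ∑ v : Fin n, μ v := by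
          rw [hμ1]; linarith [hμX, hμY]
      _ = ∑ v : Fin n, μ v * (X v + Y v - 1) := by
          rw [← Finset.sum_add_distrib, ← Finset.sum_sub_distrib]
          exact Finset.sum_congr rfl fun v _ => by ring
      _ ≤ ∑ v : Fin n, μ v * (X v * Y v) := Finset.sum_le_sum fun v _ => hXY v
  have hlow : 2 * (1 / (8 * Λ)) ≤ ∑ v : Fin n, ((U.filter fun u => u k = v).card : ℝ) / U.card *
      ((((T.filter fun t => t⁻¹ v ∈ J).card : ℝ) / T.card) *
        (((S.filter fun s => s⁻¹ v ∈ I).card : ℝ) / S.card)) := by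
    simp only [hμ, hX, hY] at hlowμ
    rw [hcS, hcT, hcU] at hlowμ
    exact hlowμ
  /- 8. the block weight: `Σ_{I×J} dA dB dC ≤ (16/15)² Σ_{I×J} dA pB pC ≤ (16/15)² Ψ ≤ 3(δ+δ₄)/n` -/
  have hΨ' : ∑ i ∈ I, ∑ j ∈ J, dA i j * dB j k * dC k i ≤ 3 * (δ + δ₄) / n := by
    have e1 : ∑ i ∈ I, ∑ j ∈ J, dA i j * dB j k * dC k i ≤
        256 / 225 * ∑ i ∈ I, ∑ j ∈ J, dA i j * pB j k * pC k i := by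
      rw [Finset.mul_sum]
      refine Finset.sum_le_sum fun i hi => ?_
      rw [Finset.mul_sum]
      refine Finset.sum_le_sum fun j hj => ?_
      have hj' := hdBp j k (hmemJ j hj)
      have hi' := hdCp k i (hmemI i hi)
      have h1615 : (0 : ℝ) ≤ 16 / 15 := by norm_num
      calc dA i j * dB j k * dC k i ≤ dA i j * (16 / 15 * pB j k) * (16 / 15 * pC k i) :=
            mul_le_mul (mul_le_mul_of_nonneg_left hj' (hdA0 i j)) hi' (hdC0 k i)
              (mul_nonneg (hdA0 i j) (mul_nonneg h1615 (hpB0 j k)))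
        _ = 256 / 225 * (dA i j * pB j k * pC k i) := by ring
    have e2 : ∑ i ∈ I, ∑ j ∈ J, dA i j * pB j k * pC k i ≤ Ψ := by
      calc ∑ i ∈ I, ∑ j ∈ J, dA i j * pB j k * pC k i
          ≤ ∑ i : Fin n, ∑ j ∈ J, dA i j * pB j k * pC k i :=
            Finset.sum_le_sum_of_subset_of_nonneg (Finset.subset_univ I) fun i _ _ =>
              Finset.sum_nonneg fun j _ => mul_nonneg (mul_nonneg (hdA0 i j) (hpB0 j k)) (hpC0 k i)
        _ ≤ ∑ i : Fin n, ∑ j : Fin n, dA i j * pB j k * pC k i :=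
            Finset.sum_le_sum fun i _ => Finset.sum_le_sum_of_subset_of_nonneg
              (Finset.subset_univ J) fun j _ _ =>
                mul_nonneg (mul_nonneg (hdA0 i j) (hpB0 j k)) (hpC0 k i)
        _ ≤ ∑ i : Fin n, ∑ j : Fin n, ∑ k' : Fin n, dA i j * pB j k' * pC k' i :=
            Finset.sum_le_sum fun i _ => Finset.sum_le_sum fun j _ =>
              Finset.single_le_sum (f := fun k' => dA i j * pB j k' * pC k' i)
                (fun k' _ => mul_nonneg (mul_nonneg (hdA0 i j) (hpB0 j k')) (hpC0 k' i))
                (Finset.mem_univ k)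
        _ = Ψ := rfl
    calc ∑ i ∈ I, ∑ j ∈ J, dA i j * dB j k * dC k i
        ≤ 256 / 225 * ∑ i ∈ I, ∑ j ∈ J, dA i j * pB j k * pC k i := e1
      _ ≤ 256 / 225 * Ψ := mul_le_mul_of_nonneg_left e2 (by norm_num)
      _ ≤ 256 / 225 * (2 * (δ + δ₄) / n) := mul_le_mul_of_nonneg_left hΨn (by norm_num)
      _ = (512 / 225 * (δ + δ₄)) / n := by ring
      _ ≤ 3 * (δ + δ₄) / n := div_le_div_of_nonneg_right (by nlinarith) hn0.le
  /- 9. `81(1+log n)⁴ η ≤ 2q²` -/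
  have hηq : 81 * (1 + Real.log n) ^ 4 * (3 * (δ + δ₄)) ≤ 2 * (1 / (8 * Λ)) ^ 2 := by
    have hG4 : (0 : ℝ) ≤ (1 + Real.log n) ^ 4 := by positivity
    have hGne : (1 + Real.log n) ≠ 0 := hG0.ne'
    have hΛne : Λ ≠ 0 := hΛ0.ne'
    have h1 : (1 + Real.log n) ^ 4 * (δ + δ₄) ≤ 1 / (7776 * Λ ^ 2) := by
      calc (1 + Real.log n) ^ 4 * (δ + δ₄)
          ≤ (1 + Real.log n) ^ 4 * (1 / (7776 * Λ ^ 2 * (1 + Real.log n) ^ 4)) :=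
            mul_le_mul_of_nonneg_left hsmall hG4
        _ = 1 / (7776 * Λ ^ 2) := by field_simp
    calc 81 * (1 + Real.log n) ^ 4 * (3 * (δ + δ₄)) = 243 * ((1 + Real.log n) ^ 4 * (δ + δ₄)) := by
          ring
      _ ≤ 243 * (1 / (7776 * Λ ^ 2)) := by linarith [h1]
      _ = 2 * (1 / (8 * Λ)) ^ 2 := by field_simp; ring
  /- 10. the general hub lemma and the arithmetic -/
  have hmain := hub_volume_dyadic hn B hB hTPP hS0 hT0 hU0 dA dB dC hdA hdB hdC k J I (1 / (8 * Λ))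
    (3 * (δ + δ₄)) (by positivity) (by linarith) hJ' hI' hlow hΨ' hηq
  exact hubSharp_const hG1 hΛ0 hn0.le (Nat.cast_nonneg B) hsmall hmain

end Summit.MatrixMultiplication.MatrixMultiplication.Theorems.PolynomialSlack
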